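import Summits.BirchSwinnertonDyer.BirchSwinnertonDyer.Theorems.PrintX11aLowerHalfNonSurjDoors
import Summits.BirchSwinnertonDyer.BirchSwinnertonDyer.Theorems.ErratumRoadFiveNonSurjCornerTwinKatoFactsContra
import HarnessLib

/-!
# Route `ErratumRoadFive` (rung K2), crux `NonSurjCorner` (item stmt-BirchSwinnertonDyer-19065) — and crux `X11aLowerHalf` (item 19064), ¬Surj
# sub-leaf at `p ≥ 5`: THE LOWER HALF AT A NON-SURJECTIVE X11a PAIR FROM `μ^an = 0`, RE-KEYED ON THE PRINT-EXACT CONTRAGREDIENT KATO PACKAGES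
# V′ ∕ VI′ ∕ XI′ — `_contraFacts` siblings of bsd-line-er5-p2's doors (`…PrintX11aLowerHalfNonSurjDoors`), for the fully twin-keyed glue #11
# (cell `bsd-stepL`, seat `bsd-stepL-corner-p1` g16; `--supports stmt-BirchSwinnertonDyer-19065 --as helper`; ARM-P R-48 END re-key)

WHY THIS FILE. In bsd-line-er5-p2's non-surjective Hida-family chain the three Kato §17.13 construction facts V ∕ VI ∕ XI enter at ONE point only:
`ClassX11a.multDivisibilityAt_of_muAnZeroAt_of_not_surj` (x11a's wrapper of this seat's `X11b.multDivisibilityAt_of_katoFacts_of_muAnZeroAt`);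
everything downstream — `invariantsMatchAt_of_modularity_ofLevel_of_multDivisibilityAt` (EPW ∕ Wan ∕ Hida), `mazurMainConjectureAt_of_invariantsMatchAt_of_multDivisibilityAt`,
the height-free rank-`0` socket `bsdp_of_mazurMainConjectureAt_heightFree`, `ClassX11a.missingLowerBoundAt_of_bsdp` — is keyed on the typed divisibility
`X11b.MultDivisibilityAt W p`. This seat's p616984 (`X11b.multDivisibilityAt_of_katoFacts_of_muAnZeroAt_contra`) produces that divisibility from the
print-exact twins V′ ∕ VI′ ∕ XI′ (p604443) through bsd-2adic's VII′ (p613557) and the μ-road re-key (p613107). THIS FILE threads it through er5-p2's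
divisibility-keyed doors UNCHANGED:
* `ClassX11a.missingLowerBoundAt_of_muAnZeroAt_of_not_surj_of_contraFacts` — er5-p2's door with `hns ∕ hsp ∕ hfine ↦ hns′ ∕ hsp′ ∕ hfine′`;
* `lowerNonSurj_fiveSeven_of_nonSurjCornerTwinMuAn_of_contraFacts` — the class-level form from item 19948's body (`Theorems.NonSurjCornerTwinMuAn`),
  er5-p2's `lowerNonSurj_fiveSeven_of_nonSurjCornerTwinMuAn_of_facts` likewise re-keyed — the `h₄ℓ` producer of glue #11.
The γ-keyed originals are untouched (x11a's line re-keys by name at leisure).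

HONEST FRAMING: THEOREMS ONLY (no definition, no named fact, no `sorry`); CONDITIONAL on the displayed named facts (V′ ∕ VI′ ∕ XI′ CONSTRUCTION facts,
print-exact per ARM-P; EPW 2006 ×3, Wan 2015 Thm 4 (irred; typer's flag), Deligne–Serre, Hida, Kato 12.4, Greenberg 1.5, Wuthrich Cor. 18, Stein–Wuthrich
6.1 ×2, GZK, Greenberg–Stevens, modularity); PER PAIR the certificate `μ^an = 0` is decidable, class-wide it is Greenberg's conjecture; nothing is
discharged; 19065 ∕ 19064 ∕ 19948 stay OPEN; nothing about any curve's BSD; BSD is not advanced; T7. Credit: bsd-line-er5-p2 (the doors and the chain),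
x11a lane (EPW ∕ Wan ∕ Hida typings), bsd-2adic tower-1 g19, defn-ty1 g18.
References (locators only): [cite: EmertonPollackWeston2006, Thm. 3.1.1, Thm. 1, Thm. 5.1.3] [cite: Wan2015, Thm. 4] [cite: Kato2004Asterisque, Thm. 12.4, §17.13]
[cite: SteinWuthrich2013, Thm. 6.1] [cite: Miller2011LMS, §1 and Def. 1.1] [cite: GreenbergLNM1716, Conj. 1.11 (shape)].
-/

set_option autoImplicit false
set_option linter.dupNamespace false

noncomputable section

open scoped Classical MatrixGroups ModularForm

open CongruenceSubgroup WeierstrassCurve Literature.NumberTheory.EllipticCurves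
  Literature.NumberTheory.EllipticCurves.ModularForms
  Literature.NumberTheory.EllipticCurves.Rank1Residual
  Literature.NumberTheory.EllipticCurves.Rank1Residual.Typed
  Literature.NumberTheory.EllipticCurves.Wuthrich2014
  Literature.NumberTheory.EllipticCurves.SteinWuthrich2013
  Literature.NumberTheory.EllipticCurves.Greenberg1999
  Literature.NumberTheory.EllipticCurves.Kato2004
  Literature.NumberTheory.EllipticCurves.GreenbergVatsal2000
  Literature.NumberTheory.EllipticCurves.EmertonPollackWeston2006
  Literature.NumberTheory.EllipticCurves.BalakrishnanEtAl2019
  Literature.NumberTheory.GaloisRepresentations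
  Summit.BirchSwinnertonDyer.Rank1Residual
  Summit.BirchSwinnertonDyer.Rank1Residual.X1.MuLambda
  Summit.BirchSwinnertonDyer.Rank1Residual.X11a
  Summit.BirchSwinnertonDyer.Rank1Residual.X11a.LambdaNorm
  Summit.BirchSwinnertonDyer.Rank1Residual.X11a.Chain

namespace Summit.BirchSwinnertonDyer.BirchSwinnertonDyer.Theorems.NonSurjChain

section Doors

variable {W : WeierstrassCurve ℚ} [W.IsElliptic] [W.IsGloballyMinimal] {p : ℕ} [Fact p.Prime]

/-- **THE LOWER HALF at a NON-surjective X11a pair, `p ≥ 5`, from the certificate `μ^an(E,p) = 0` ALONE, on the PRINT-EXACT contragredient Kato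
packages** — bsd-line-er5-p2's `ClassX11a.missingLowerBoundAt_of_muAnZeroAt_of_not_surj_of_facts` with its only V ∕ VI ∕ XI consumer (the typed
divisibility) produced instead by `X11b.multDivisibilityAt_of_katoFacts_of_muAnZeroAt_contra` (V′ ∕ VI′ ∕ XI′ + modularity for the newform level);
the divisibility-keyed chain (invariants match ⟹ Mazur MC ⟹ BSDp ⟹ lower half) VERBATIM. PER PAIR; closes nothing class-wide.
[cite: Miller2011LMS, §1 and Def. 1.1] [cite: EmertonPollackWeston2006, Thm. 5.1.3] [cite: Wan2015, Thm. 4] [cite: Kato2004Asterisque, §17.13 (pp. 279–280)]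
[cite: SteinWuthrich2013, Thm. 6.1 (p. 20)] -/
theorem _root_.Summit.BirchSwinnertonDyer.Rank1Residual.ClassX11a.missingLowerBoundAt_of_muAnZeroAt_of_not_surj_of_contraFacts
    (hNf : exists_isNewformOf)
    (h311 : thm311_cotorsion_weightK_member_ofLevel) (hT1a : thm1_muAlg_of_weightK_member_ofLevel)
    (hT2 : Wan2015.thm4_rational_weightK_member_of_bdd_ofLevel_irred)
    (hT1b : thm513_transfer_from_weightK_member_of_bdd_ofLevel)
    (h61 : DeligneSerre1974.thm61_exists_adicGaloisRep) (h326 : Hida2000_thm326_ordinary)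
    (h12 : Kato2004.thm12_4)
    (hns' : Kato2004.exists_multDivisibilityInputs_nonsplit_contra)
    (hsp' : Kato2004.exists_multDivisibilityInputs_split_contra)
    (h15 : thm15_isTorsion_multiplicative_rat)
    (h18 : Wuthrich2014.corollary18_padicLFunction_mem_iwasawaAlgebra_multiplicative)
    (hfine' : Kato2004.exists_multDivisibilityInputs_fine_contra)
    (hJs : thm61_splitMultiplicative) (hJn : thm61_nonsplitMultiplicative)
    (hGZK : rank_eq_analyticRank_of_analyticRank_le_one)
    (hGS : greenberg_stevens (W := W) (p := p))
    (hX : ClassX11a W p) (hnsj : ¬ Surj W p) (hp : 5 ≤ p) (hμ : X11a.MuAnZeroAt W p) :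
    MissingLowerBoundAt W p := by
  have hdiv : X11b.MultDivisibilityAt W p :=
    X11b.multDivisibilityAt_of_katoFacts_of_muAnZeroAt_contra Kato2004.nonempty_iwasawaH1Data_holds h12 hNf hns' hsp'
      h15 h18 hfine' W p hX.ne_two hX.mult hX.irr hnsj hμ
  have hMC : X2.MazurMainConjectureAt W p :=
    mazurMainConjectureAt_of_invariantsMatchAt_of_multDivisibilityAt
      (hasEntireLFunction_rat_of_exists_isNewformOf hNf) W p hGS hdiv hX.analyticRank_eq_zero
      (invariantsMatchAt_of_modularity_ofLevel_of_multDivisibilityAt W p hNf h311 hT1a hT2 hT1b h61 h326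
        hp hX.mult hX.irr hdiv hμ)
  have hpar : nonempty_modularParametrizationData :=
    nonempty_modularParametrizationData_of_exists_isNewformOf hNf
      IsNewformOf.exists_maninConstant_ne_zero_holds
  exact hX.missingLowerBoundAt_of_bsdp hGZK
    (bsdp_of_mazurMainConjectureAt_heightFree hJs hJn hGZK (hasEntireLFunction_rat_of_exists_isNewformOf hNf)
      hpar hGS hX hMC)

end Doors

section ClassLevel

/-- **The lower half on the whole non-surjective X11a locus at `p ∈ {5,7}` from `Theorems.NonSurjCornerTwinMuAn` (item 19948) and the named facts,
on the PRINT-EXACT contragredient Kato packages** — bsd-line-er5-p2's `lowerNonSurj_fiveSeven_of_nonSurjCornerTwinMuAn_of_facts` with `hns ∕ hsp ∕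
hfine ↦ hns′ ∕ hsp′ ∕ hfine′`: `p ∣ ord_p Δ_min` is automatic from `¬ Surj` (`ClassX11a.surj_of_not_dvd`), the certificate is read off 19948's body
in the allowable-root currency (`muAnZeroAt_of_allowableRootShape`), then the previous door. This is the `h₄ℓ` producer of the fully twin-keyed hybrid
glue #11 of crux 19065. CONDITIONAL on 19948 + facts; closes nothing by itself.
[cite: GreenbergLNM1716, Conj. 1.11 (shape)] [cite: SilvermanATAEC1994, V.6 Prop. 6.1 (p. 410)] [cite: EmertonPollackWeston2006, Thm. 5.1.3] [cite: Wan2015, Thm. 4] -/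
theorem lowerNonSurj_fiveSeven_of_nonSurjCornerTwinMuAn_of_contraFacts
    (hNf : exists_isNewformOf)
    (h311 : thm311_cotorsion_weightK_member_ofLevel) (hT1a : thm1_muAlg_of_weightK_member_ofLevel)
    (hT2 : Wan2015.thm4_rational_weightK_member_of_bdd_ofLevel_irred)
    (hT1b : thm513_transfer_from_weightK_member_of_bdd_ofLevel)
    (h61 : DeligneSerre1974.thm61_exists_adicGaloisRep) (h326 : Hida2000_thm326_ordinary)
    (h12 : Kato2004.thm12_4)
    (hns' : Kato2004.exists_multDivisibilityInputs_nonsplit_contra)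
    (hsp' : Kato2004.exists_multDivisibilityInputs_split_contra)
    (h15 : thm15_isTorsion_multiplicative_rat)
    (h18 : Wuthrich2014.corollary18_padicLFunction_mem_iwasawaAlgebra_multiplicative)
    (hfine' : Kato2004.exists_multDivisibilityInputs_fine_contra)
    (hJs : thm61_splitMultiplicative) (hJn : thm61_nonsplitMultiplicative)
    (hGZK : rank_eq_analyticRank_of_analyticRank_le_one)
    (hGS : ∀ (W : WeierstrassCurve ℚ) [W.IsElliptic] [W.IsGloballyMinimal] (p : ℕ) [Fact p.Prime],
      greenberg_stevens (W := W) (p := p))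
    (h57 : Summit.BirchSwinnertonDyer.BirchSwinnertonDyer.Theorems.NonSurjCornerTwinMuAn) :
    ∀ (W : WeierstrassCurve ℚ) [W.IsElliptic] [W.IsGloballyMinimal] (p : ℕ) [Fact p.Prime],
      ClassX11a W p → ¬ Surj W p → (p = 5 ∨ p = 7) → MissingLowerBoundAt W p := by
  intro W _ _ p _ hX hnsj h57'
  have hp : 5 ≤ p := by rcases h57' with rfl | rfl <;> omega
  have hdvd : p ∣ padicValInt p W.minimalDiscriminantInt := by
    by_contra hΔ
    exact hnsj (ClassX11a.surj_of_not_dvd W p hX hΔ)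
  have hμ : X11a.MuAnZeroAt W p :=
    muAnZeroAt_of_allowableRootShape W p (fun f hf ϖ hϖ a L h1 h2 hL =>
      h57 W p hX hnsj h57' hdvd f hf ϖ hϖ a L h1 h2 hL)
  exact hX.missingLowerBoundAt_of_muAnZeroAt_of_not_surj_of_contraFacts hNf h311 hT1a hT2 hT1b h61 h326 h12 hns'
    hsp' h15 h18 hfine' hJs hJn hGZK (hGS W p) hnsj hp hμ

end ClassLevel

end Summit.BirchSwinnertonDyer.BirchSwinnertonDyer.Theorems.NonSurjChain

end
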